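import Literature.MathematicalPhysics.QuantumFieldTheory.Balaban1983to89.B8Eq191FlatLettersDentedCubeMember
import Literature.MathematicalPhysics.QuantumFieldTheory.Balaban1983to89.B8DentedCubeMemberZdRec
import Literature.MathematicalPhysics.QuantumFieldTheory.Balaban1983to89.B8Eq131CubesRecDictionary

/-!
# `Balaban1983to89.B8Eq191FlatLettersDentedCubeMemberRec` — RECORD TWIN of `B8Eq191FlatLettersDentedCubeMember` §1 (the carrier's laws the flat-letters consumers ask: finiteness of
# the truncated dented cells and of `Ω′₀`, `Ω′_j ⊆ Ω′₀`, and the TOWER LAWS «every truncated cell label is the `Lʲ`-block label of a fine site of `Ω′₀`» ∕ «distinct cells have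
# disjoint towers») FOR THE SYMMETRISED CENTRED block averaging (0.4) of [Balaban1987RG1] — at the record datum `c : Node00.CubeB8DZ d L K Ω` (centred block labels `flmZ`)

statement-level skeleton of published theorems with citation tags; proofs where landed; nothing here is a claim about the Yang–Mills mass gap

T. Bałaban, *Spaces of regular gauge field configurations on a lattice and gauge fixing conditions*, Commun. Math. Phys. **99** (1985) 75–102 `[Balaban1985RegularSpaces]`
("[6]"): (1.3)–(1.6) p. 77, (1.68) p. 88, p. 98, (1.131) p. 99; T. Bałaban, *The variational problem and background fields in renormalization group method for lattice gauge
theories*, Commun. Math. Phys. **102** (1985) 277–309 `[Balaban1985Variational]` ("[15]"): (148)–(150) p. 301; T. Bałaban, *Renormalization group approach to lattice gauge field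
theories. I*, Commun. Math. Phys. **109** (1987) 249–301 `[Balaban1987RG1]` ("[I]"): (0.3)–(0.4) pp. 252–253.  STATUS: published.

CITATION HEADER (lean-in-tree rule).  Cell `pub-ymgap`, «N05-REC» stage 2 (director-ym №254∕№255∕№288), item R6 crown tail, «side file independent of Sect. E» — typed by
`pub-ymgap-dag-n07-w3` g11 on the LEAD PEN dag-n05-e g39's word «TAKE» (cell bus 2026-08-29 14:45Z); engine module by dag-n05-e g32.  WHAT IS REPRODUCED = ✓ the engine's
`lamST_finite` · `sq_zero_finite` · `sq_antitone` · `sq_subset_zero` · `tower_meets_dented` · `towers_disjoint_dented` under the token map, for the consumer (g)-4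
`B8Prop6DentedCubeMemberFlatScalarGammaRec` (engine `B8Prop6DentedCubeMemberFlatScalarGamma` :289–:312, the binders `hS ∕ hB ∕ hsub ∕ hmeet ∕ hdisj` of dag-n05-e's record consumer
`B8Eq191FlatLettersRDOfRealRec.flatLettersZRD_of_real`).  TOKEN MAP (T2, centred tower; odd `L`): `CubeB8D ↦ Node00.CubeB8DZ`, `CubeB8D.lamST ↦ CubeB8DZ.lamST`, the corner block
label `blockMap (Lʲ)` (= `flm L j`) ↦ the CENTRED label `flmZ L j` of `B8Eq119TwistedAxialRec`.  PROOFS = the engine theorems at the (T2) translation `c.translate`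
(`Node00/CarriersB8CubeDentedRecTranslate`) carried back by `B8DentedCubeMemberZdRec.mem_lamST_iff_add_ctrShift` ∕ `add_ctrShift_mem_translate_sq_iff` ∕ `mem_translate_sq_iff_sub`
(dag-n05-e g38) and `B8Eq131CubesRecDictionary.flm_add_ctrShift` (n07-w3 g10: `flm L j (z + c_k·𝟙) = flmZ L j z + c_{k−j}·𝟙`); `sq_antitone` directly from `CubeB8DZ.sq_succ_subset`.
Declaration names = engine names (T5).  Kind «kernel-checked proof», theorems only; no `def`, no `instance`, no `notation`, no existing module modified.  `--supports
stmt-QuantumFields-20541` (K0⁷-keyed, COUNT-NEUTRAL).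

HONEST SCOPE: set algebra ∕ finiteness on the dented record tower carried through a translation; no estimate; nothing of [6]∕[15]∕[I] asserted; `HThm4Rec` UNDISCHARGED; caveat
(C-S3-1) + addendum v4 stand; N05 [B8] DISCHARGED OF RECORD untouched; N05 ∕ N07 NOT discharged; COUNT of record unmoved · K numerically unchanged; one finite `𝕋⁴` programme at fixed
`ε`, Bałaban AS PRINTED; nothing continuum ∕ ℝ⁴ ∕ OS ∕ mass-gap ∕ Clay.  No `sorry`, no `def`.

[cite: Balaban1985RegularSpaces, (1.3)–(1.6) p.77, (1.68) p.88, p.98, (1.131) p.99; Balaban1985Variational, (148)–(150) p.301; Balaban1987RG1, (0.3)–(0.4) pp.252–253]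
-/

noncomputable section

namespace Literature.MathematicalPhysics.QuantumFieldTheory.Balaban1983to89.B8Eq191FlatLettersDentedCubeMemberRec

open B7Prop1Explicit B7Prop1Local
open BlockAveragingZd (ctrShift)
open B8Eq131Cubes (flm)
open B8Eq119TwistedAxialRec (flmZ)
open B8Eq131CubesRecDictionary (flm_add_ctrShift)
open B8Eq191FlatLettersCubeMember (blockMap_pow_eq_flm)
open B8DentedCubeMemberZdRec (mem_lamST_iff_add_ctrShift add_ctrShift_mem_translate_sq_iff mem_translate_sq_iff_sub)
open Literature.MathematicalPhysics.QuantumLattice (blockMap)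
open Node00 (CubeB8D CubeB8DZ)

-- `Site` alone would resolve to the torus sites of `Setup.lean`; re-export the `ℤ^d` sites of `B7Prop1Explicit`.
export B7Prop1Explicit (Site)

variable {d : ℕ} {L K : ℕ} {Ω : ℕ → Set (Site d)} (c : CubeB8DZ d L K Ω)

/-! ## §1  Finiteness and nesting -/

/-- (RECORD TWIN of `B8Eq191FlatLettersDentedCubeMember.lamST_finite`.) The truncated dented record cells are finite (odd `L`).
[cite: Balaban1985RegularSpaces, (1.68) p.88; Balaban1985Variational, (148) p.301; Balaban1987RG1, (0.3) p.252] -/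
theorem lamST_finite (hL : Odd L) (m j : ℕ) : (c.lamST m j).Finite := by
  have h : c.lamST m j = (fun z : Site d => z + fun _ => (ctrShift L (c.k - j) : ℤ)) ⁻¹' (c.translate hL).lamST m j :=
    Set.ext fun z => mem_lamST_iff_add_ctrShift c hL m j z
  rw [h]
  exact (B8Eq191FlatLettersDentedCubeMember.lamST_finite (c.translate hL) m j).preimage (Set.injOn_of_injective (add_left_injective _))

/-- (RECORD TWIN of `B8Eq191FlatLettersDentedCubeMember.sq_zero_finite`.) `Ω′₀ = □₀` is finite (odd `L`). [cite: Balaban1985RegularSpaces, p.98; Balaban1985Variational, (150) p.301; Balaban1987RG1, (0.3) p.252] -/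
theorem sq_zero_finite (hL : Odd L) : (c.sq 0).Finite := by
  have h : c.sq 0 = (fun x : Site d => x + fun _ => (ctrShift L c.k : ℤ)) ⁻¹' (c.translate hL).sq 0 :=
    Set.ext fun x => (add_ctrShift_mem_translate_sq_iff c hL 0 x).symm
  rw [h]
  exact (B8Eq191FlatLettersDentedCubeMember.sq_zero_finite (c.translate hL)).preimage (Set.injOn_of_injective (add_left_injective _))

/-- (RECORD TWIN of `B8Eq191FlatLettersDentedCubeMember.sq_antitone`.) `Ω′_b ⊆ Ω′_a` for `a ≤ b` (iterated (1.3) on the dented record tower, odd `L`).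
[cite: Balaban1985RegularSpaces, (1.3) p.77; Balaban1985Variational, (150) p.301] -/
theorem sq_antitone (hL : Odd L) {a b : ℕ} (hab : a ≤ b) : c.sq b ⊆ c.sq a := by
  induction hab with
  | refl => exact subset_rfl
  | step _ ih => exact (c.sq_succ_subset hL _).trans ih

/-- (RECORD TWIN of `B8Eq191FlatLettersDentedCubeMember.sq_subset_zero`.) `Ω′_j ⊆ Ω′₀` — the `hsub` binder of the flat-letters consumers (odd `L`).
[cite: Balaban1985RegularSpaces, (1.3) p.77; Balaban1985Variational, (150) p.301] -/
theorem sq_subset_zero (hL : Odd L) : ∀ j, c.sq j ⊆ c.sq 0 := fun j => sq_antitone c hL (Nat.zero_le j)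

/-! ## §2  The tower laws of the truncated dented record cells (centred labels `flmZ`) -/

/-- (RECORD TWIN of `B8Eq191FlatLettersDentedCubeMember.tower_meets_dented`.) ★ **EVERY TRUNCATED DENTED RECORD CELL LABEL IS THE CENTRED `Lʲ`-BLOCK LABEL OF A FINE SITE OF
`Ω′₀`** (`hmeet` of `flatLettersZRD_of_real`; odd `L`, `m ≤ k`). [cite: Balaban1985RegularSpaces, (1.5)–(1.6) p.77, p.98, (1.131) p.99; Balaban1985Variational, (148)–(150) p.301; Balaban1987RG1, (0.3) p.252] -/
theorem tower_meets_dented (hL : Odd L) {m : ℕ} (hm : m ≤ c.k) :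
    ∀ j, j ≤ m → ∀ y ∈ c.lamST m j, ∃ z ∈ c.sq 0, flmZ L j z = y := by
  intro j hj y hy
  have hL1 : 1 ≤ L := hL.pos
  have hjk : j ≤ c.k := hj.trans hm
  obtain ⟨z', hz', hzy⟩ := B8Eq191FlatLettersDentedCubeMember.tower_meets_dented (c.translate hL) hL1 (by simpa using hm) j hj _
    ((mem_lamST_iff_add_ctrShift c hL m j y).1 hy)
  refine ⟨z' - fun _ => (ctrShift L c.k : ℤ), (mem_translate_sq_iff_sub c hL 0 z').1 hz', ?_⟩
  have h := flm_add_ctrShift hL hjk (z' - fun _ => (ctrShift L c.k : ℤ))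
  rw [sub_add_cancel, ← blockMap_pow_eq_flm, hzy] at h
  exact (add_right_cancel h).symm

/-- (RECORD TWIN of `B8Eq191FlatLettersDentedCubeMember.towers_disjoint_dented`.) ★ **DISTINCT TRUNCATED DENTED RECORD CELLS HAVE DISJOINT TOWERS IN `Ω′₀`** (`hdisj` of
`flatLettersZRD_of_real`; odd `L`, `m ≤ k`). [cite: Balaban1985RegularSpaces, (1.5)–(1.6) p.77, (1.68) p.88, (1.131) p.99; Balaban1985Variational, (148)–(150) p.301; Balaban1987RG1, (0.3) p.252] -/
theorem towers_disjoint_dented (hL : Odd L) {m : ℕ} (hm : m ≤ c.k) :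
    ∀ j, j ≤ m → ∀ j', j' ≤ m → ∀ y ∈ c.lamST m j, ∀ y' ∈ c.lamST m j', ∀ z ∈ c.sq 0,
      flmZ L j z = y → flmZ L j' z = y' → j = j' ∧ y = y' := by
  intro j hj j' hj' y hy y' hy' z hz hzy hzy'
  have hL1 : 1 ≤ L := hL.pos
  have hjk : j ≤ c.k := hj.trans hm
  have hjk' : j' ≤ c.k := hj'.trans hm
  have h1 : blockMap (L ^ j) (z + fun _ => (ctrShift L c.k : ℤ)) = y + fun _ => (ctrShift L (c.k - j) : ℤ) := by
    rw [blockMap_pow_eq_flm, flm_add_ctrShift hL hjk, hzy]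
  have h2 : blockMap (L ^ j') (z + fun _ => (ctrShift L c.k : ℤ)) = y' + fun _ => (ctrShift L (c.k - j') : ℤ) := by
    rw [blockMap_pow_eq_flm, flm_add_ctrShift hL hjk', hzy']
  obtain ⟨hjj, hyy⟩ := B8Eq191FlatLettersDentedCubeMember.towers_disjoint_dented (c.translate hL) hL1 (by simpa using hm) j hj j' hj' _
    ((mem_lamST_iff_add_ctrShift c hL m j y).1 hy) _ ((mem_lamST_iff_add_ctrShift c hL m j' y').1 hy') _
    ((add_ctrShift_mem_translate_sq_iff c hL 0 z).2 hz) h1 h2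
  subst hjj
  exact ⟨rfl, add_right_cancel hyy⟩

end Literature.MathematicalPhysics.QuantumFieldTheory.Balaban1983to89.B8Eq191FlatLettersDentedCubeMemberRec

end
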